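import Literature.NumberTheory.Automorphic.ArchDiagonalTorus        -- ★ `circleDiagonal`, `archLocal`, `circleDiagonal_mem_unitaryGroupOfForm_diagonal`, `mem_unitaryGroupOfForm_iff`
import Mathlib.Analysis.SpecialFunctions.Trigonometric.DerivHyp    -- `Real.cosh`, `Real.sinh`, `Real.cosh_sq`
import HarnessLib

/-!
# The place charts of the inner form `G′_w = U(diag a)(ℂ)`: the sign-adapted slot order `lineOf`, the standard boost, the compact and split charts, membership
# ((T-ATLAS) PART 2a — LH3-plan (g2) frame ruling «EXPLICIT BOOST» 2026-09-02T05:28:27Z; Rogawski 1990 §3.6; Knapp 1986 V §3)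

Topic `NumberTheory/Automorphic`; namespace `Literature.NumberTheory.Automorphic.UnitaryGroup`.  DEFINITIONS WITH BODIES `oddLine`, `lineOf`, `boostStd`, `gprimeCptGL`,
`gprimeSplitMatrix`, `gprimeSplitGL` + theorems (no instance, no notation, no axiom, no `sorry`, no `Classical.choose` in a definition).  Cell `pub/hodgecm-mathlib`, crux H413
(`stmt-HodgeConjecture-24833`), F0∕P3c line LH3, DIRECT ROAD of `stub_N9` (D2′-SPEC §1 «Cartan atlas of `G′_∞`»); seat LH3-p03 (g2), organ (T-ATLAS) PART 2 of LH3-plan (g2)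
DEALER WORDS #6, frame ruling 05:28:27Z: «`gprimeTorus S′ c` as a CLOSED FORMULA on the DIAGONAL frame `diagonal (σ_w α)`: at `w ∈ S′` the boost
`e^{iθ}·(cosh x, r sinh x; r⁻¹ sinh x, cosh x)`, `r² = |σ_w α_odd| ∕ |σ_w α_p|`, on the plane (`p w` := the FIRST even-sign line in matrix order, `odd w`), the remaining even line
carries `e^{i c w 1}`; at `w ∉ S′` the unit diagonal in sign-adapted slot order; state the slot ↦ line map `lineOf (s w) : Fin 3 ≃ Fin 3` once as a def».  This file is the
ONE-PLACE layer over a real diagonal form `diag(a₀, a₁, a₂)`; the `G′_∞`-assembly `gprimeTorus S′ c` (through ★ `archPiEquivCM`, as ★ `endoTorus`), its regular set, the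
Cayley wall and the partner lemma are PART 2b.  Count-neutral chart file.

CONVENTION (one slot map for BOTH charts — the (COORD) ★ `ArchCartanCoordinates` currency `cayPt ∕ InRegG ∕ flipAt` reads the `(0, 2)` wall as the Cayley wall and slot `1`
as «the compact line»): for a sign vector `s` (`s_i = sgn a_i`), `oddLine s` is the minority-sign line and **`lineOf s` sends slot `0 ↦ p` (the first even-sign line), slot
`1 ↦` the second even-sign line, slot `2 ↦ oddLine s`**.  So at a compact chart the angles `c 0, c 1, c 2` sit on the lines `p`, second-even, odd; the wall `c 0 ≡ c 2` is
noncompact (`sign_apply_lineOf`: slots `0, 2` carry opposite signs at an indefinite place) and is the `x = 0` edge of the split chart with the SAME `lineOf` (`θ = c 2` on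
the plane `(p, odd)`, `φ = c 1` on the second even line) — the exact analogue of ★ `endoTorus_of_wall` (`c w ↦ (0, c w 1, c w 0)`).  The ruling's phrase «slot 1 ↦ the odd
line» for compact charts is NOT used: with it the (COORD) Cayley wall `(0, 2)` would be a compact wall; the two slot orders differ by the realised same-sign swap, so no
class is lost (documented for LH3-plan (g2) ∕ LH3-p02 (g3)'s κ-TABLE).

THE MATHEMATICS.  STANDARD POSITION (slots as indices, form `diag(b)`, `b = a ∘ lineOf s`, so `b₀ b₂ < 0` at an indefinite place — `mul_apply_lineOf_neg`): the boost
`B(b; x, φ, θ) = (e^{iθ}cosh x, 0, e^{iθ} r sinh x; 0, e^{iφ}, 0; e^{iθ} r⁻¹ sinh x, 0, e^{iθ} cosh x)`, `r = √(−b₂∕b₀)`, `x = c 0`, `φ = c 1`, `θ = c 2`, preserves `diag(b)`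
exactly because `r² b₀ = −b₂` and `cosh² − sinh² = 1` (`conjTranspose_boostStd_mul_diagonal_mul`); eigenvalues `e^{±x+iθ}` on the plane, `e^{iφ}` on slot `1`; `det B =
e^{iφ}e^{2iθ}(cosh² x − r r⁻¹ sinh² x) ≠ 0` for EVERY `b` (`det_boostStd_ne_zero`), so the charts are total `GL₃(ℂ)`-valued maps and only MEMBERSHIP carries the sign
hypothesis.  PLACE POSITION: re-index by `τ = lineOf s` — `gprimeSplitMatrix τ a c = (boostStd (a ∘ τ) c).submatrix τ⁻¹ τ⁻¹`, and `Bᴴ diag(a ∘ τ) B = diag(a ∘ τ)` transports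
to `Mᴴ diag(a) M = diag(a)` (`conjTranspose_submatrix_mul_diagonal_mul_submatrix`); the compact chart is ★ `circleDiagonal (ℓ ↦ e^{i c (τ⁻¹ ℓ)})`, in `U(diag e)(ℂ)` for every `e`.
* §1 `oddLine`, `lineOf`, `lineOf_two : lineOf s 2 = oddLine s`, `lineOf_zero_lt_lineOf_one`, `sign_apply_lineOf`, `mul_apply_lineOf_neg`;
* §2 `boostStd`, `conjTranspose_boostStd_mul_diagonal_mul (hb : b 0 * b 2 < 0)`, `det_boostStd`, `det_boostStd_ne_zero`, `continuous_boostStd`;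
* §3 `conjTranspose_submatrix_mul_diagonal_mul_submatrix`, `transpose_map_starRingEnd_complex`; **`gprimeCptGL τ c`**, `coe_gprimeCptGL`,
  **`gprimeCptGL_mem_unitaryGroupOfForm_diagonal`** (every diagonal form), `continuous_gprimeCptGL`; **`gprimeSplitMatrix τ a c`**, **`gprimeSplitGL τ a c`**, `coe_gprimeSplitGL`,
  `det_gprimeSplitMatrix_ne_zero`, **`gprimeSplitGL_mem_unitaryGroupOfForm_diagonal (h : a (τ 0) * a (τ 2) < 0)`** (in the ★ `mem_unitaryGroupOfForm_iff` spelling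
  `unitaryGroupOfForm (starRingEnd ℂ) (diagonal (↑a))` = `archLocal` of a diagonal form at a place), `continuous_gprimeSplitGL`.
HONEST LABEL: HC_CM is proved only modulo the 7 printed citations (2 remaining: hLiu418 = `stmt-HodgeConjecture-24832`, h413 = `stmt-HodgeConjecture-24833`) until rung 0
closes; chart bookkeeping, count-neutral (+0∕+0).

## References
* [Rogawski1990] J. D. Rogawski, *Automorphic Representations of Unitary Groups in Three Variables*, Ann. of Math. Stud. 123 (1990), §3.6 p. 31 (the two classes of Cartan
  subgroups of `U(2,1)`, one of `U(3)`), §1.9 p. 8, §4.9 p. 54.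
* [Knapp1986] A. W. Knapp, *Representation Theory of Semisimple Groups* (1986), Ch. V §3 (Cartan subgroups of `SU(2,1)`: the compact torus and the `MA` torus with a boost).
* [Shelstad1979] D. Shelstad, *Characters and inner forms of a quasi-split group over ℝ*, Compositio Math. 39 (1979), §4 pp. 22–25 (Cayley transform at a noncompact wall).
* [Mok2014] C. P. Mok, *Endoscopic classification of representations of quasi-split unitary groups*, Mem. AMS 235 (2015), §1 Notation p. 5 (the `ᵗc(g) J g = J` spelling).
-/

set_option autoImplicit false

noncomputable section

open Matrix Complex
open scoped MatrixGroups Matrix ComplexConjugate Real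

namespace Literature.NumberTheory.Automorphic.UnitaryGroup

/-! ## §1 The sign-adapted slot order -/

section Slots

/-- **The minority-sign («odd») line** of a sign vector `s : Fin 3 → SignType`: `2` if `s₀ = s₁` (this covers the definite case), else `1` if `s₀ = s₂`, else `0`.
[cite: Rogawski1990, §3.6 p. 31] -/
def oddLine (s : Fin 3 → SignType) : Fin 3 :=
  if s 0 = s 1 then 2 else if s 0 = s 2 then 1 else 0

/-- **The slot ↦ line map `lineOf s : Fin 3 ≃ Fin 3`** ((COORD) ★ `cayPt` ∕ `InRegG` convention, the same at compact and at split charts): slot `0 ↦ p` = the FIRST even-sign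
line in matrix order, slot `1 ↦` the second even-sign line (the «compact line», which carries the angle `c w 1` in both charts), slot `2 ↦ oddLine s`; so the `(0, 2)` wall
`e^{i c w 0} = e^{i c w 2}` of a compact chart is the NONCOMPACT (Cayley) wall and `(0, 1)` the compact one.  (`refl` if the odd line is `2`, `swap 1 2` if it is `1`, the cycle
`0 ↦ 1 ↦ 2 ↦ 0` if it is `0`.) [cite: Rogawski1990, §3.6 p. 31] [cite: Shelstad1979, §4 p. 23] -/
def lineOf (s : Fin 3 → SignType) : Fin 3 ≃ Fin 3 :=
  if oddLine s = 2 then Equiv.refl _ else if oddLine s = 1 then Equiv.swap 1 2 else (Equiv.swap 1 2).trans (Equiv.swap 0 1)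

/-- Slot `2` is the odd line. [cite: Rogawski1990, §3.6 p. 31] -/
theorem lineOf_two (s : Fin 3 → SignType) : lineOf s 2 = oddLine s := by
  unfold lineOf
  by_cases h2 : oddLine s = 2
  · rw [if_pos h2, h2]; decide
  · rw [if_neg h2]
    by_cases h1 : oddLine s = 1
    · rw [if_pos h1, h1]; decide
    · rw [if_neg h1]
      have : oddLine s = 0 ∨ oddLine s = 1 ∨ oddLine s = 2 := by
        generalize oddLine s = k; fin_cases k <;> simp
      rcases this with h | h | h
      · rw [h]; decide
      · exact absurd h h1
      · exact absurd h h2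

/-- Slots `0 < 1` go to the two even lines in matrix order: `lineOf s 0 < lineOf s 1`. [cite: Rogawski1990, §3.6 p. 31] -/
theorem lineOf_zero_lt_lineOf_one (s : Fin 3 → SignType) : lineOf s 0 < lineOf s 1 := by
  unfold lineOf
  by_cases h2 : oddLine s = 2
  · rw [if_pos h2]; decide
  · rw [if_neg h2]
    by_cases h1 : oddLine s = 1
    · rw [if_pos h1]; decide
    · rw [if_neg h1]; decide

/-- **Signs along the slots at an indefinite place**: if no `s_i` vanishes and the signs are not all equal, then slots `0, 1` carry the common (majority) sign and slot `2` the
opposite one: `s (lineOf s 1) = s (lineOf s 0)` and `s (lineOf s 2) = −s (lineOf s 0)`. [cite: Rogawski1990, §3.6 p. 31] -/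
theorem sign_apply_lineOf {s : Fin 3 → SignType} (h0 : s 0 ≠ 0) (h1 : s 1 ≠ 0) (h2 : s 2 ≠ 0) (hind : ¬ (s 0 = s 1 ∧ s 1 = s 2)) :
    s (lineOf s 1) = s (lineOf s 0) ∧ s (lineOf s 2) = -s (lineOf s 0) := by
  have hs : s = ![s 0, s 1, s 2] := by funext i; fin_cases i <;> rfl
  rw [hs]
  revert h0 h1 h2 hind
  generalize s 0 = t0
  generalize s 1 = t1
  generalize s 2 = t2
  revert t0 t1 t2
  decide

/-- **At an indefinite place the boost plane `(lineOf s 0, lineOf s 2)` is hyperbolic**: for `a : Fin 3 → ℝ` with no zero entry and signs `s_i = sgn a_i` not all equal,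
`a (lineOf s 0) · a (lineOf s 2) < 0`. [cite: Rogawski1990, §3.6 p. 31] [cite: Knapp1986, Ch. V §3] -/
theorem mul_apply_lineOf_neg {a : Fin 3 → ℝ} (ha : ∀ i, a i ≠ 0)
    (hind : ¬ (SignType.sign (a 0) = SignType.sign (a 1) ∧ SignType.sign (a 1) = SignType.sign (a 2))) :
    a (lineOf (fun i => SignType.sign (a i)) 0) * a (lineOf (fun i => SignType.sign (a i)) 2) < 0 := by
  set s : Fin 3 → SignType := fun i => SignType.sign (a i) with hs
  have hne : ∀ i, s i ≠ 0 := fun i h => ha i (sign_eq_zero_iff.1 h)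
  obtain ⟨-, h02⟩ := sign_apply_lineOf (hne 0) (hne 1) (hne 2) hind
  have key : SignType.sign (a (lineOf s 0) * a (lineOf s 2)) = -1 := by
    rw [sign_mul]
    change s (lineOf s 0) * s (lineOf s 2) = -1
    rw [h02]
    have h := hne (lineOf s 0)
    revert h
    generalize s (lineOf s 0) = t
    revert t
    decide
  exact sign_eq_neg_one_iff.1 key

end Slots

/-! ## §2 The standard-position blocks over a real diagonal form `diag(b)` -/

section Standard

/-- **The standard boost** `B(b; c) = (e^{iθ}cosh x, 0, e^{iθ} r sinh x; 0, e^{iφ}, 0; e^{iθ} r⁻¹ sinh x, 0, e^{iθ} cosh x)`, `x = c 0`, `φ = c 1`, `θ = c 2`,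
`r = √(−b₂∕b₀)` — the hyperbolic element of the noncompact Cartan of `U(diag b)(ℂ)` through the real root on slots `(0, 2)` (eigenvalues `e^{±x+iθ}` there, `e^{iφ}` on slot `1`).
[cite: Knapp1986, Ch. V §3] [cite: Rogawski1990, §3.6 p. 31] -/
def boostStd (b : Fin 3 → ℝ) (c : Fin 3 → ℝ) : Matrix (Fin 3) (Fin 3) ℂ :=
  !![Complex.exp ((c 2 : ℂ) * I) * (Real.cosh (c 0) : ℂ), 0, Complex.exp ((c 2 : ℂ) * I) * (Real.sqrt (-b 2 / b 0) : ℂ) * (Real.sinh (c 0) : ℂ);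
     0, Complex.exp ((c 1 : ℂ) * I), 0;
     Complex.exp ((c 2 : ℂ) * I) * ((Real.sqrt (-b 2 / b 0))⁻¹ : ℂ) * (Real.sinh (c 0) : ℂ), 0, Complex.exp ((c 2 : ℂ) * I) * (Real.cosh (c 0) : ℂ)]

/-- **The boost preserves `diag(b)` when `b₀ b₂ < 0`**: `B̄ᵀ · diag(b) · B = diag(b)` (`r² b₀ = −b₂`, `cosh² x − sinh² x = 1`, `|e^{iθ}| = |e^{iφ}| = 1`).
[cite: Knapp1986, Ch. V §3] [cite: Rogawski1990, §1.9 p. 8] -/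
theorem conjTranspose_boostStd_mul_diagonal_mul {b : Fin 3 → ℝ} (hb : b 0 * b 2 < 0) (c : Fin 3 → ℝ) :
    (boostStd b c)ᴴ * Matrix.diagonal (fun i => (b i : ℂ)) * boostStd b c = Matrix.diagonal (fun i => (b i : ℂ)) := by
  have hb0 : b 0 ≠ 0 := fun h => by rw [h, zero_mul] at hb; exact lt_irrefl _ hb
  have hq : 0 ≤ -b 2 / b 0 := by
    rcases lt_or_gt_of_ne hb0 with h | h
    · have : 0 < b 2 := by nlinarith
      exact le_of_lt (div_pos_of_neg_of_neg (by linarith) h)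
    · have : b 2 < 0 := by nlinarith
      exact le_of_lt (div_pos (by linarith) h)
  set r : ℝ := Real.sqrt (-b 2 / b 0) with hr
  have hr2 : r ^ 2 = -b 2 / b 0 := Real.sq_sqrt hq
  have hr0 : r ≠ 0 := by
    intro h
    have : -b 2 / b 0 = 0 := by rw [← hr2, h]; ring
    rcases div_eq_zero_iff.1 this with h' | h'
    · have : b 2 = 0 := by linarith
      rw [this, mul_zero] at hb; exact lt_irrefl _ hb
    · exact hb0 h'
  have hb2 : b 2 ≠ 0 := fun h => by rw [h, mul_zero] at hb; exact lt_irrefl _ hb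
  -- the real identities
  have hA : b 0 * r ^ 2 = -b 2 := by rw [hr2]; field_simp
  have hB : b 2 * r⁻¹ ^ 2 = -b 0 := by
    have hr2' : r⁻¹ ^ 2 = b 0 / (-b 2) := by rw [inv_pow, hr2]; field_simp
    rw [hr2']; field_simp
  have key1 : (b 0 : ℝ) * Real.cosh (c 0) ^ 2 + b 2 * r⁻¹ ^ 2 * Real.sinh (c 0) ^ 2 = b 0 := by
    linear_combination (b 0) * Real.cosh_sq (c 0) + Real.sinh (c 0) ^ 2 * hB
  have key2 : (b 0 : ℝ) * r ^ 2 * Real.sinh (c 0) ^ 2 + b 2 * Real.cosh (c 0) ^ 2 = b 2 := by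
    linear_combination Real.sinh (c 0) ^ 2 * hA + (b 2) * Real.cosh_sq (c 0)
  have key3 : (b 0 : ℝ) * r + b 2 * r⁻¹ = 0 := by
    have h5 : b 0 * r ^ 2 + b 2 = 0 := by linear_combination hA
    calc (b 0 : ℝ) * r + b 2 * r⁻¹ = (b 0 * r ^ 2 + b 2) * r⁻¹ := by field_simp
      _ = 0 := by rw [h5, zero_mul]
  -- unit phases
  have hθ : conj (Complex.exp ((c 2 : ℂ) * I)) * Complex.exp ((c 2 : ℂ) * I) = 1 := by
    rw [← Complex.exp_conj, ← Complex.exp_add, map_mul, Complex.conj_ofReal, Complex.conj_I]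
    have : (c 2 : ℂ) * -I + (c 2 : ℂ) * I = 0 := by ring
    rw [this, Complex.exp_zero]
  have hφ : conj (Complex.exp ((c 1 : ℂ) * I)) * Complex.exp ((c 1 : ℂ) * I) = 1 := by
    rw [← Complex.exp_conj, ← Complex.exp_add, map_mul, Complex.conj_ofReal, Complex.conj_I]
    have : (c 1 : ℂ) * -I + (c 1 : ℂ) * I = 0 := by ring
    rw [this, Complex.exp_zero]
  -- complex forms of the keys
  have key1C : (b 0 : ℂ) * (Real.cosh (c 0) : ℂ) ^ 2 + (b 2 : ℂ) * ((r : ℂ)⁻¹) ^ 2 * (Real.sinh (c 0) : ℂ) ^ 2 = (b 0 : ℂ) := by exact_mod_cast key1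
  have key2C : (b 0 : ℂ) * (r : ℂ) ^ 2 * (Real.sinh (c 0) : ℂ) ^ 2 + (b 2 : ℂ) * (Real.cosh (c 0) : ℂ) ^ 2 = (b 2 : ℂ) := by exact_mod_cast key2
  have key3C : (b 0 : ℂ) * (r : ℂ) + (b 2 : ℂ) * (r : ℂ)⁻¹ = 0 := by exact_mod_cast key3
  ext i j
  fin_cases i <;> fin_cases j <;>
    simp [boostStd, Matrix.mul_apply, Matrix.conjTranspose_apply, Matrix.diagonal_apply, Fin.sum_univ_three, ← hr,
      -Complex.ofReal_cosh, -Complex.ofReal_sinh]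
  -- (0,0)
  · linear_combination (Real.cosh (c 0) : ℂ) ^ 2 * (b 0 : ℂ) * hθ + ((r : ℂ)⁻¹) ^ 2 * (Real.sinh (c 0) : ℂ) ^ 2 * (b 2 : ℂ) * hθ + key1C
  -- (0,2)
  · linear_combination (Real.cosh (c 0) : ℂ) * (Real.sinh (c 0) : ℂ) * ((b 0 : ℂ) * (r : ℂ) + (b 2 : ℂ) * (r : ℂ)⁻¹) * hθ + (Real.cosh (c 0) : ℂ) * (Real.sinh (c 0) : ℂ) * key3C
  -- (1,1)
  · linear_combination (b 1 : ℂ) * hφ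
  -- (2,0)
  · linear_combination (Real.cosh (c 0) : ℂ) * (Real.sinh (c 0) : ℂ) * ((b 0 : ℂ) * (r : ℂ) + (b 2 : ℂ) * (r : ℂ)⁻¹) * hθ + (Real.cosh (c 0) : ℂ) * (Real.sinh (c 0) : ℂ) * key3C
  -- (2,2)
  · linear_combination (r : ℂ) ^ 2 * (Real.sinh (c 0) : ℂ) ^ 2 * (b 0 : ℂ) * hθ + (Real.cosh (c 0) : ℂ) ^ 2 * (b 2 : ℂ) * hθ + key2C

/-- **The determinant of the boost**: `det B(b; c) = e^{iφ} e^{2iθ} (cosh² x − r r⁻¹ sinh² x)` (`= e^{iφ} e^{2iθ}` when `r ≠ 0`). [cite: Knapp1986, Ch. V §3] -/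
theorem det_boostStd (b c : Fin 3 → ℝ) :
    (boostStd b c).det = Complex.exp ((c 1 : ℂ) * I) * Complex.exp ((c 2 : ℂ) * I) ^ 2 *
      ((Real.cosh (c 0) ^ 2 - Real.sqrt (-b 2 / b 0) * (Real.sqrt (-b 2 / b 0))⁻¹ * Real.sinh (c 0) ^ 2 : ℝ) : ℂ) := by
  simp [Matrix.det_fin_three, boostStd, -Complex.ofReal_cosh, -Complex.ofReal_sinh]
  ring

/-- **`det B(b; c) ≠ 0`** for ALL `b` (`cosh² x − r r⁻¹ sinh² x ∈ {1, cosh² x}`), so the boost is a `GL₃(ℂ)` element with no hypothesis. [cite: Knapp1986, Ch. V §3] -/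
theorem det_boostStd_ne_zero (b c : Fin 3 → ℝ) : (boostStd b c).det ≠ 0 := by
  rw [det_boostStd]
  set r : ℝ := Real.sqrt (-b 2 / b 0)
  have hrr : r * r⁻¹ ≤ 1 := by
    by_cases hr : r = 0
    · rw [hr, zero_mul]; exact zero_le_one
    · rw [mul_inv_cancel₀ hr]
  have hK : 0 < Real.cosh (c 0) ^ 2 - r * r⁻¹ * Real.sinh (c 0) ^ 2 := by
    nlinarith [Real.cosh_sq (c 0), mul_nonneg (sub_nonneg.2 hrr) (sq_nonneg (Real.sinh (c 0)))]
  exact mul_ne_zero (mul_ne_zero (Complex.exp_ne_zero _) (pow_ne_zero _ (Complex.exp_ne_zero _))) (by exact_mod_cast hK.ne')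

/-- The boost depends continuously on `c = (x, φ, θ)`. [cite: Knapp1986, Ch. V §3] -/
theorem continuous_boostStd (b : Fin 3 → ℝ) : Continuous fun c : Fin 3 → ℝ => boostStd b c := by
  have h0 : Continuous fun c : Fin 3 → ℝ => (Real.cosh (c 0) : ℂ) := Complex.continuous_ofReal.comp (Real.continuous_cosh.comp (continuous_apply 0))
  have h0' : Continuous fun c : Fin 3 → ℝ => (Real.sinh (c 0) : ℂ) := Complex.continuous_ofReal.comp (Real.continuous_sinh.comp (continuous_apply 0))
  have h1 : Continuous fun c : Fin 3 → ℝ => Complex.exp ((c 1 : ℂ) * I) :=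
    Complex.continuous_exp.comp ((Complex.continuous_ofReal.comp (continuous_apply 1)).mul continuous_const)
  have h2 : Continuous fun c : Fin 3 → ℝ => Complex.exp ((c 2 : ℂ) * I) :=
    Complex.continuous_exp.comp ((Complex.continuous_ofReal.comp (continuous_apply 2)).mul continuous_const)
  refine continuous_matrix fun i j => ?_
  fin_cases i <;> fin_cases j
  · exact h2.mul h0
  · exact continuous_const
  · exact (h2.mul continuous_const).mul h0'
  · exact continuous_const
  · exact h1
  · exact continuous_const
  · exact (h2.mul continuous_const).mul h0'
  · exact continuous_const
  · exact h2.mul h0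

end Standard

/-! ## §3 The place charts: the standard blocks re-indexed to the lines by `τ = lineOf s` -/

section Reindex

variable {n : Type*} [Fintype n] [DecidableEq n] {R : Type*} [CommRing R] [StarRing R]

/-- **Re-indexing transports form-preservation**: if `Bᴴ · diag(d ∘ τ) · B = diag(d ∘ τ)` then `M = B.submatrix τ⁻¹ τ⁻¹` satisfies `Mᴴ · diag(d) · M = diag(d)`
(`Matrix.submatrix_mul_equiv`, `submatrix_diagonal_equiv`). [cite: Rogawski1990, §1.9 p. 8] -/
theorem conjTranspose_submatrix_mul_diagonal_mul_submatrix (B : Matrix n n R) (d : n → R) (τ : n ≃ n)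
    (h : Bᴴ * Matrix.diagonal (d ∘ τ) * B = Matrix.diagonal (d ∘ τ)) :
    (B.submatrix τ.symm τ.symm)ᴴ * Matrix.diagonal d * B.submatrix τ.symm τ.symm = Matrix.diagonal d := by
  have hd : Matrix.diagonal d = (Matrix.diagonal (d ∘ τ)).submatrix τ.symm τ.symm := by
    rw [Matrix.submatrix_diagonal_equiv]
    congr 1
    funext i
    simp only [Function.comp_apply, Equiv.apply_symm_apply]
  rw [Matrix.conjTranspose_submatrix, hd, Matrix.submatrix_mul_equiv, Matrix.submatrix_mul_equiv, h]

/-- `(M.map conj)ᵀ = Mᴴ` over `ℂ` — the ★ `mem_unitaryGroupOfForm_iff` spelling versus `Matrix.conjTranspose` (definitional). [cite: Mok2014, §1 Notation p. 5] -/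
theorem transpose_map_starRingEnd_complex {m k : Type*} (M : Matrix m k ℂ) : (M.map (starRingEnd ℂ))ᵀ = Mᴴ := rfl

end Reindex

section PlaceCharts

variable (τ : Fin 3 ≃ Fin 3)

/-- **The compact place chart** `diag`-type element with the angle `c k` on the line `τ k` (`k = 0, 1, 2`): `circleDiagonal (ℓ ↦ e^{i c (τ⁻¹ ℓ)})` — at `w ∉ S′` with `τ = lineOf (s w)`.
[cite: Rogawski1990, §3.6 p. 31] -/
def gprimeCptGL (c : Fin 3 → ℝ) : GL (Fin 3) ℂ :=
  circleDiagonal 3 fun ℓ => Circle.exp (c (τ.symm ℓ))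

/-- The matrix of the compact chart: `diag(e^{i c (τ⁻¹ ℓ)})`. [cite: Rogawski1990, §3.6 p. 31] -/
theorem coe_gprimeCptGL (c : Fin 3 → ℝ) :
    ((gprimeCptGL τ c : GL (Fin 3) ℂ) : Matrix (Fin 3) (Fin 3) ℂ) = Matrix.diagonal fun ℓ => Complex.exp ((c (τ.symm ℓ) : ℂ) * I) := by
  rw [gprimeCptGL, coe_circleDiagonal]
  rfl

/-- **The compact chart lies in `U(diag e)(ℂ)` for EVERY diagonal form** (★ `circleDiagonal_mem_unitaryGroupOfForm_diagonal`). [cite: Rogawski1990, §4.9 p. 54] -/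
theorem gprimeCptGL_mem_unitaryGroupOfForm_diagonal (c : Fin 3 → ℝ) (e : Fin 3 → ℂ) :
    gprimeCptGL τ c ∈ unitaryGroupOfForm (starRingEnd ℂ) (Matrix.diagonal e) :=
  circleDiagonal_mem_unitaryGroupOfForm_diagonal 3 _ e

/-- The compact chart is continuous in `c`. [cite: Rogawski1990, §3.6 p. 31] -/
theorem continuous_gprimeCptGL : Continuous fun c : Fin 3 → ℝ => gprimeCptGL τ c :=
  (continuous_circleDiagonal 3).comp (continuous_pi fun ℓ => Circle.exp.continuous.comp (continuous_apply (τ.symm ℓ)))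

variable (a : Fin 3 → ℝ)

/-- **The split place chart (matrix)**: the standard boost for `b = a ∘ τ` re-indexed to the lines, `(boostStd (a ∘ τ) c).submatrix τ⁻¹ τ⁻¹` — boost on the plane
`(τ 0, τ 2)` with `r = √(−a (τ 2) ∕ a (τ 0))`, the angle `c 1` on the line `τ 1`; at `w ∈ S′` with `τ = lineOf (s w)` this is the plane `(p w, odd w)`. [cite: Knapp1986, Ch. V §3]
[cite: Rogawski1990, §3.6 p. 31] -/
def gprimeSplitMatrix (c : Fin 3 → ℝ) : Matrix (Fin 3) (Fin 3) ℂ :=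
  (boostStd (a ∘ τ) c).submatrix τ.symm τ.symm

/-- `det (gprimeSplitMatrix a τ c) ≠ 0` (re-indexing preserves `det`). [cite: Knapp1986, Ch. V §3] -/
theorem det_gprimeSplitMatrix_ne_zero (c : Fin 3 → ℝ) : (gprimeSplitMatrix τ a c).det ≠ 0 := by
  rw [gprimeSplitMatrix, Matrix.det_submatrix_equiv_self]
  exact det_boostStd_ne_zero _ _

/-- **The split place chart** as a `GL₃(ℂ)` element (total in `a`, `τ`, `c`). [cite: Knapp1986, Ch. V §3] [cite: Rogawski1990, §3.6 p. 31] -/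
def gprimeSplitGL (c : Fin 3 → ℝ) : GL (Fin 3) ℂ :=
  Matrix.GeneralLinearGroup.mkOfDetNeZero (gprimeSplitMatrix τ a c) (det_gprimeSplitMatrix_ne_zero τ a c)

/-- The matrix of `gprimeSplitGL`. [cite: Knapp1986, Ch. V §3] -/
theorem coe_gprimeSplitGL (c : Fin 3 → ℝ) : ((gprimeSplitGL τ a c : GL (Fin 3) ℂ) : Matrix (Fin 3) (Fin 3) ℂ) = gprimeSplitMatrix τ a c := by
  rw [gprimeSplitGL, Matrix.GeneralLinearGroup.val_mkOfDetNeZero]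

/-- **The split chart lies in `U(diag a)(ℂ)` when its plane is hyperbolic**, `a (τ 0) · a (τ 2) < 0` (automatic for `τ = lineOf s` at an indefinite place:
`mul_apply_lineOf_neg`). [cite: Knapp1986, Ch. V §3] [cite: Rogawski1990, §1.9 p. 8] -/
theorem gprimeSplitGL_mem_unitaryGroupOfForm_diagonal (h : a (τ 0) * a (τ 2) < 0) (c : Fin 3 → ℝ) :
    gprimeSplitGL τ a c ∈ unitaryGroupOfForm (starRingEnd ℂ) (Matrix.diagonal fun i => (a i : ℂ)) := by
  rw [mem_unitaryGroupOfForm_iff, coe_gprimeSplitGL, transpose_map_starRingEnd_complex, gprimeSplitMatrix]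
  exact conjTranspose_submatrix_mul_diagonal_mul_submatrix _ _ τ (conjTranspose_boostStd_mul_diagonal_mul (b := a ∘ τ) h c)

/-- The split chart is continuous in `c` (entries of the boost; inverse through `det⁻¹ • adjugate`). [cite: Knapp1986, Ch. V §3] -/
theorem continuous_gprimeSplitGL : Continuous fun c : Fin 3 → ℝ => gprimeSplitGL τ a c := by
  have hval : Continuous fun c : Fin 3 → ℝ => gprimeSplitMatrix τ a c := (continuous_boostStd (a ∘ τ)).matrix_submatrix τ.symm τ.symm
  refine Units.continuous_iff.mpr ⟨?_, ?_⟩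
  · have e : (fun c : Fin 3 → ℝ => ((gprimeSplitGL τ a c : GL (Fin 3) ℂ) : Matrix (Fin 3) (Fin 3) ℂ)) = fun c => gprimeSplitMatrix τ a c := by
      funext c; exact coe_gprimeSplitGL τ a c
    exact (show Continuous fun c : Fin 3 → ℝ => ((gprimeSplitGL τ a c : GL (Fin 3) ℂ) : Matrix (Fin 3) (Fin 3) ℂ) from e ▸ hval)
  · have e : (fun c : Fin 3 → ℝ => (((gprimeSplitGL τ a c)⁻¹ : GL (Fin 3) ℂ) : Matrix (Fin 3) (Fin 3) ℂ)) =
        fun c => ((gprimeSplitMatrix τ a c).det)⁻¹ • (gprimeSplitMatrix τ a c).adjugate := by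
      funext c
      rw [Matrix.coe_units_inv, coe_gprimeSplitGL, Matrix.inv_def, Ring.inverse_eq_inv]
    show Continuous fun c : Fin 3 → ℝ => (((gprimeSplitGL τ a c)⁻¹ : GL (Fin 3) ℂ) : Matrix (Fin 3) (Fin 3) ℂ)
    rw [e]
    exact ((hval.matrix_det).inv₀ fun c => det_gprimeSplitMatrix_ne_zero τ a c).smul hval.matrix_adjugate

end PlaceCharts

end Literature.NumberTheory.Automorphic.UnitaryGroup

end
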